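import Summits.BirchSwinnertonDyer.Rank1Residual.X11b.BDPRouteSelmerCardBoundTorsion
import Summits.BirchSwinnertonDyer.Rank1Residual.X11b.BDPRouteSelmerCountLemmas
import HarnessLib

/-!
# X11b, routes p2/R1 — FINITENESS and the Selmer bound for Castella's `Sel_𝔭(K, E[p^∞])` at a
# RANK-ONE datum (the inputs `rank E(K) = 1`, `Ш(E/K)` finite taken as hypotheses, not via Kolyvagin)
# (cell `b2b-bsdres`, sub-cell `multr1-p2`, gen 19)

HONEST FRAMING (verbatim, cell `b2b-bsdres`): "We develop the residual theory around the BSD formula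
for a specific rank-1 curve class, assuming the known deep theorems (Gross–Zagier, Kolyvagin,
Kato, Skinner–Urban) as cited black boxes (conditional/label B). No claim of proving BSD outright;
every result is labelled (A) Mathlib-unconditional, (B) conditional on cited literature theorems
stated as hypotheses, or (C) speculative." This file is label **(B)**: CONDITIONAL on the textbook
named facts `poitouTate_sum_localTatePairing_eq_zero K` (Milne ADT I 4.10, reciprocity half) and
`localEulerPoincareCharacteristic (K_v)` (Milne ADT I 2.8), hypotheses. Nothing booked; class X11b
stays CONSTRUCTION-SHAPED; no label change.

## What this file proves

`selmerCardBoundTorsion_of_rankOne` — gen 18's `selmerCardBoundTorsion_datum_of_facts`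
(`#Sel_𝔭(K,E[p^∞]) · #E(ℚ_p)[p^∞] ≤ p^a`, `a ≤ ord_p #Ш[p^∞] + 2((ord_p log_ω P − 1) − ord_p[E(K):ℤP])
+ ord_p ∏_{w∣p} c_w`, in particular `Sel_𝔭(K, E[p^∞])` is FINITE) with the arithmetic inputs
`rank E(K) = 1` and `Ш(E/K)` finite as HYPOTHESES instead of Kolyvagin's theorem on a Heegner datum —
so that it applies verbatim on route R1's data (generalised Heegner hypothesis, where the tree's
`kolyvagin` does not) and serves as the finiteness input of the EXACT count
(`BDPRouteSelmerCountExact`). The proof is gen 18's, unchanged (JSW17 Prop. 3.2.1 `≤` at every level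
`p^k`, passage to the limit).

References: [JetchevSkinnerWan2017] Prop. 3.2.1; [Castella2018] Thm. 2.3 (proof); [MilneADT2006]
I 4.10, 2.8; [GreenbergLNM1716] §3.
-/

noncomputable section

open scoped Classical

open WeierstrassCurve NumberField IsDedekindDomain Field
open Literature.NumberTheory.EllipticCurves Literature.NumberTheory.EllipticCurves.GreenbergSelmer
  Literature.NumberTheory.EllipticCurves.Rank1Residual
  Literature.NumberTheory.EllipticCurves.Rank1Residual.Typed
  Literature.NumberTheory.GaloisRepresentations Literature.NumberTheory.GaloisCohomology
  Summit.BirchSwinnertonDyer.Rank1Residual.X11b.AcSelmer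
  Summit.BirchSwinnertonDyer.Rank1Residual.X11b.LocBridge

namespace Summit.BirchSwinnertonDyer.Rank1Residual.X11b

/-- **The Selmer bound `#Sel_𝔭(K,E[p^∞])·#E(ℚ_p)[p^∞] ≤ p^a` (hence FINITENESS of Castella's Selmer
group over `K`) at a RANK-ONE datum, ANY prime `p` of multiplicative reduction with `E[p]`
irreducible**: `K` imaginary quadratic with `p` split, `rank E(K) = 1`, `Ш(E/K)` finite, `P ∈ E(K)`
non-torsion, `𝔭 ∣ p` of degree one. Gen 18's `selmerCardBoundTorsion_datum_of_facts` with the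
Kolyvagin step replaced by its two outputs as hypotheses. CONDITIONAL on the two named facts.
[cite: JetchevSkinnerWan2017, Prop. 3.2.1 (proof, arXiv:1512.06894 pp. 10–11)]
[cite: Castella2018, proof of Thm. 2.3, (3.2.1) and (calcul) (arXiv:1704.06608 pp. 5–6)]
[cite: MilneADT2006, Ch. I, Thm. 4.10(b) and Thm. 2.8] -/
theorem selmerCardBoundTorsion_of_rankOne (W : WeierstrassCurve ℚ) [W.IsElliptic]
    [W.IsGloballyMinimal] (p : ℕ) [Fact p.Prime] (K : Type) [Field K] [NumberField K]
    (hPT : poitouTate_sum_localTatePairing_eq_zero K)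
    (hEP : ∀ v : HeightOneSpectrum (𝓞 K), localEulerPoincareCharacteristic (v.adicCompletion K))
    (hmult : Mult W p) (hirr : Irr W p) (hK : IsImaginaryQuadratic K) (hsplit : SplitsIn K p)
    (hrank : (W.baseChange K).mordellWeilRank = 1) (hSha : (W.baseChange K).ShaFinite)
    (P : (W.baseChange K).toAffine.Point) (hPinf : ¬ IsOfFinAddOrder P)
    (𝔭 : HeightOneSpectrum (𝓞 K)) (h𝔭 : ((p : ℕ) : 𝓞 K) ∈ 𝔭.asIdeal)
    (he : 𝔭.asIdeal.ramificationIdx (𝓞 ℚ) = 1) (hf : 𝔭.asIdeal.inertiaDeg (𝓞 ℚ) = 1) :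
    ∃ (_ : Finite (selmerAcBase (W.baseChange K) p 𝔭 ∅)) (a : ℕ),
      Nat.card (selmerAcBase (W.baseChange K) p 𝔭 ∅) *
          Nat.card (AddCommGroup.primaryComponent (W.baseChange ℚ_[p]).toAffine.Point p) ≤
        p ^ a ∧
      (a : ℤ) ≤
        (padicValNat p (Nat.card (AddCommGroup.primaryComponent (W.baseChange K).sha p)) : ℤ) +
        2 * ((padicLogOrd W p (embAt K p 𝔭 h𝔭 he hf) P - 1) -
          (padicValNat p (AddSubgroup.zmultiples P).index : ℤ)) +
          padicValNat p (tamagawaProductAbove W K p) := by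
  revert P
  set E := W.baseChange K with hEdef
  set G := W.baseChange ℚ_[p] with hGdef
  intro P hPinf
  haveI hEK : E.IsElliptic := by rw [hEdef, baseChange]; infer_instance
  have h2 : Module.finrank ℚ K = 2 := hK.1
  have hp : p.Prime := Fact.out
  -- Kolyvagin: `rank E(K) = 1`, `Ш(E/K)` finite
  haveI hShaFin : Finite E.sha := hSha
  set ιp := embAt K p 𝔭 h𝔭 he hf with hιp
  set f : E.toAffine.Point →+ G.toAffine.Point := Affine.Point.map (W' := W) ιp.toRatAlgHom with hfdef
  have hfapply : ∀ x, f x = padicPointOf W p ιp x := fun _ => rfl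
  have hfinj : Function.Injective f := Affine.Point.map_injective (W' := W) ιp.toRatAlgHom
  -- no `p`-torsion in `E(K)` (from `Irr`, `K` quadratic)
  have hivK : ∀ x : E.toAffine.Point, p • x = 0 → x = 0 :=
    Transvection.forall_torsion_eq_zero_of_irr W p hirr K h2
  -- a coordinate `c : E(K) → ℤ` and a generator `Q`
  obtain ⟨c, Q, hcQ, hcker⟩ := RankOne.exists_coord_of_mordellWeilRank_eq_one E hrank
  have hA : ∀ a : E.toAffine.Point, IsOfFinAddOrder (a - c a • Q) :=
    RankOne.isOfFinAddOrder_sub_coord_zsmul c Q hcQ hcker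
  have hQinf : ¬ IsOfFinAddOrder Q := fun hQ => by
    have h := RankOne.coord_eq_zero_of_isOfFinAddOrder c hQ
    rw [hcQ] at h
    exact one_ne_zero h
  have hxinf : ¬ IsOfFinAddOrder (f Q) := fun hx => hQinf ((hfinj.isOfFinAddOrder_iff).mp hx)
  have hyinf : ¬ IsOfFinAddOrder (f P) := fun hy => hPinf ((hfinj.isOfFinAddOrder_iff).mp hy)
  have hcP : c P ≠ 0 := fun h0 => hPinf (hcker P h0)
  -- the `ℤ_p`-coordinate `Ψ` on `E(ℚ_p)`: `Ψ(E(ℚ_p)) = p^m ℤ_p`, `p^m = #E(ℚ_p)[p^∞]`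
  haveI hfi2 : (G.formalFiltration 2).FiniteIndex := G.finiteIndex_formalFiltration 2
  set cp := padicValNat p (G.localTamagawaNumber ℤ_[p]) with hcpdef
  obtain ⟨φ, hφ⟩ := LocalIndex.exists_addEquiv_valuation_psi_padicPointOf_of_mult W p hmult (K := K)
  obtain ⟨m, hmrange, hmcard, hmle⟩ :=
    LocalIndex.exists_pow_eq_card_and_le_valuation_psi (G.formalFiltration 2) φ
  set Ψ := LocalIndex.psi (G.formalFiltration 2) φ with hΨ
  set eQ := (Ψ (f Q)).valuation with heQdef
  set eP := (Ψ (f P)).valuation with hePdef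
  have hΨQ : Ψ (f Q) ≠ 0 := fun h0 => hxinf ((LocalIndex.psi_eq_zero_iff _ φ _).mp h0)
  have hmeQ : m ≤ eQ := hmle (f Q) hΨQ
  -- the exponents: `e(P) = padicLogOrd P + c_p − 1`, `e(P) = ord_p c(P) + e(Q)`
  have heP : (eP : ℤ) = padicLogOrd W p ιp P + cp - 1 := hφ ιp P hyinf
  have hyx : f P = c P • f Q + f (P - c P • Q) := by rw [map_sub, map_zsmul]; abel
  have hePQ : eP = padicValNat p (c P).natAbs + eQ := by
    rw [hePdef, hyx]
    exact LocalIndex.valuation_psi_zsmul_add (G.formalFiltration 2) φ hxinf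
      (f.isOfFinAddOrder (hA P)) hcP
  -- `ord_p [E(K) : ℤP] = ord_p |c(P)|`
  haveI : Finite (AddCommGroup.torsion E.toAffine.Point) := E.finite_torsion_point
  have hI : padicValNat p (AddSubgroup.zmultiples P).index = padicValNat p (c P).natAbs :=
    RankOne.padicValNat_index_zmultiples_eq c Q hcQ hcker hivK P hcP
  -- (v) `ord_p ∏_{w∣p} c_w = 2 ord_p c_p`
  have htam : padicValNat p (tamagawaProductAbove W K p) = 2 * cp :=
    LocalIndexTransport.padicValNat_tamagawaProductAbove_eq_two_mul W K p h2 hsplit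
  -- the two primes above `p`
  obtain ⟨σ, 𝔮, hσ, -, -, hall⟩ := LocalIndexTransport.exists_conj_prime_of_splitsIn K p h2 hsplit h𝔭
  have h𝔮 : ∀ v : HeightOneSpectrum (𝓞 K), v ≠ 𝔭 → ((p : ℕ) : 𝓞 K) ∈ v.asIdeal → v = 𝔮 :=
    fun v hv hpv => (hall v hpv).resolve_left hv
  -- `Ш[p^k] ⊆ Ш[p^∞]`, `#Ш[p^∞] = p^v`
  set S := Nat.card (AddCommGroup.primaryComponent E.sha p) with hSdef
  obtain ⟨v, hv⟩ : ∃ v : ℕ, S = p ^ v := exists_natCard_primaryComponent_eq_pow p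
  -- THE LEVEL BOUNDS
  set B : ℕ := (p ^ (eQ - m) * p ^ m) * (S * p ^ (eQ - m)) with hBdef
  have hlevel : ∀ k, Finite (acLevelStructure E p k 𝔭 ∅).selmerGroup ∧
      Nat.card (acLevelStructure E p k 𝔭 ∅).selmerGroup ≤ B := by
    intro k
    rcases Nat.eq_zero_or_pos k with rfl | hk
    · obtain ⟨hfin, hle⟩ := finite_and_natCard_selmerGroup_acLevelStructure_zero E p 𝔭 ∅
      refine ⟨hfin, hle.trans ?_⟩
      have hS1 : 1 ≤ S := by rw [hv]; exact Nat.one_le_pow _ _ hp.pos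
      calc 1 ≤ S := hS1
        _ ≤ S * p ^ (eQ - m) := Nat.le_mul_of_pos_right _ (pow_pos hp.pos _)
        _ ≤ (p ^ (eQ - m) * p ^ m) * (S * p ^ (eQ - m)) :=
            Nat.le_mul_of_pos_left _ (Nat.mul_pos (pow_pos hp.pos _) (pow_pos hp.pos _))
    · -- the indices at level `k`, read in `E(ℚ_p)` through `Ψ`
      have hL₁ : ((Affine.Point.baseChange (W' := W.baseChange K) K (𝔭.adicCompletion K)).range ⊔
          (zsmulAddGroupHom ((p ^ k : ℕ) : ℤ) :
            ((W.baseChange K).baseChange (𝔭.adicCompletion K)).toAffine.Point →+ _).range).index ≤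
          p ^ min k (eQ - m) * p ^ m := by
        rw [LocalIndexTransport.index_range_baseChange_sup_eq_padic K p 𝔭 h𝔭 he hf W,
          RankOne.range_zsmulAddGroupHom_natCast, sup_comm]
        change ((nsmulAddMonoidHom (p ^ k) : G.toAffine.Point →+ _).range ⊔ f.range).index ≤ _
        rw [LocalIndex.range_nsmul_sup_range_eq_of_source f c Q hA k hivK, hmcard]
        exact LocalIndex.index_range_nsmul_sup_zmultiples_le (G.formalFiltration 2) φ hmrange
          (f Q) hxinf k
      have hM : (AddCommGroup.torsion ((W.baseChange K).baseChange (𝔭.adicCompletion K)).toAffine.Point ⊔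
          (zsmulAddGroupHom ((p ^ k : ℕ) : ℤ) :
            ((W.baseChange K).baseChange (𝔭.adicCompletion K)).toAffine.Point →+ _).range).index =
          p ^ k := by
        rw [index_torsion_sup_range_zsmul_eq_padic K p 𝔭 h𝔭 he hf W,
          RankOne.range_zsmulAddGroupHom_natCast]
        exact LocalIndex.index_torsion_sup_range_nsmul (G.formalFiltration 2) φ k
      have hN : ((zsmulAddGroupHom ((p ^ k : ℕ) : ℤ) : E.toAffine.Point →+ _).range).index =
          p ^ k := RankOne.index_range_zsmul_pow_eq c Q hcQ hcker hivK k
      have hL₂ : ((Affine.Point.baseChange (W' := W.baseChange K) K (𝔭.adicCompletion K)).range ⊔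
          (AddCommGroup.torsion ((W.baseChange K).baseChange (𝔭.adicCompletion K)).toAffine.Point ⊔
            (zsmulAddGroupHom ((p ^ k : ℕ) : ℤ) :
              ((W.baseChange K).baseChange (𝔭.adicCompletion K)).toAffine.Point →+ _).range)).index =
          p ^ min k (eQ - m) := by
        rw [index_range_baseChange_sup_torsion_sup_eq_padic K p 𝔭 h𝔭 he hf W,
          RankOne.range_zsmulAddGroupHom_natCast]
        change (f.range ⊔ (AddCommGroup.torsion G.toAffine.Point ⊔
          (nsmulAddMonoidHom (p ^ k) : G.toAffine.Point →+ _).range)).index = _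
        have hrw : f.range ⊔ (AddCommGroup.torsion G.toAffine.Point ⊔
            (nsmulAddMonoidHom (p ^ k) : G.toAffine.Point →+ _).range) =
            AddCommGroup.torsion G.toAffine.Point ⊔
              ((nsmulAddMonoidHom (p ^ k) : G.toAffine.Point →+ _).range ⊔
                AddSubgroup.zmultiples (f Q)) := by
          rw [← LocalIndex.range_nsmul_sup_range_eq_of_source f c Q hA k hivK]
          ac_rfl
        rw [hrw]
        exact LocalIndex.index_torsion_sup_range_nsmul_sup_zmultiples (G.formalFiltration 2) φ
          hmrange (f Q) hxinf k
      obtain ⟨hfin, hle⟩ := SelmerLevelBound.natCard_level_le_of_indices_torsion W K p k 𝔭 𝔮 hk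
        σ hσ h𝔮 hPT (hEP 𝔮) rfl hM (pow_ne_zero _ hp.ne_zero) hN hL₂
        (natCard_sha_inf_torsionBy_le E p k)
      refine ⟨hfin, hle.trans ?_⟩
      have hmin : p ^ min k (eQ - m) ≤ p ^ (eQ - m) := Nat.pow_le_pow_right hp.pos (min_le_right _ _)
      exact Nat.mul_le_mul (hL₁.trans (Nat.mul_le_mul_right _ hmin))
        (Nat.mul_le_mul_left _ hmin)
  -- pass to the limit
  obtain ⟨hfinSel, hcard⟩ := LevelKummer.exists_finite_selmerAcBase_natCard_le E p 𝔭 ∅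
    E.zsmul_geomPoints_surjective_holds B (fun k => (hlevel k).1) (fun k => (hlevel k).2)
  refine ⟨hfinSel, v + 2 * eQ, ?_, ?_⟩
  · rw [← hmcard]
    calc Nat.card (selmerAcBase E p 𝔭 ∅) * p ^ m ≤ B * p ^ m := Nat.mul_le_mul_right _ hcard
      _ = p ^ (v + 2 * eQ) := by
          rw [hBdef, hv, ← pow_add, ← pow_add, ← pow_add, ← pow_add]
          congr 1
          omega
  · have hvS : padicValNat p S = v := by rw [hv, padicValNat.prime_pow]
    rw [hvS, hI, htam]
    have hePQZ : (eP : ℤ) = (padicValNat p (c P).natAbs : ℤ) + (eQ : ℤ) := by exact_mod_cast hePQ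
    have hcast : (((v + 2 * eQ : ℕ) : ℤ)) = (v : ℤ) + 2 * (eQ : ℤ) := by push_cast; ring
    have hcast2 : (((2 * cp : ℕ) : ℤ)) = 2 * (cp : ℤ) := by push_cast; ring
    rw [hcast, hcast2]
    linarith [hePQZ, heP]

/-- **The same bound and FINITENESS assuming only `Ш(E/K)[p^∞]` finite** (instead of all of
`Ш(E/K)`) — the form in which Gross–Zagier–Kolyvagin descent over a quadratic field supplies the
input (`mordellWeilRank_baseChange_eq_one_and_finite_sha`: `rank E(K) = 1 ∧ Ш(E/K)[p^∞]` finite from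
`rank E(ℚ) = 1`, `Ш(E/ℚ)` finite, `rank E^{(d_K)}(ℚ) = 0`, `Ш(E^{(d_K)}/ℚ)` finite), used to discharge
route R1's atom (P6) on its data. Same proof. CONDITIONAL on the two named facts.
[cite: JetchevSkinnerWan2017, Prop. 3.2.1 (proof, arXiv:1512.06894 pp. 10–11)]
[cite: Castella2018, proof of Thm. 2.3, (3.2.1) and (calcul) (arXiv:1704.06608 pp. 5–6)]
[cite: MilneADT2006, Ch. I, Thm. 4.10(b) and Thm. 2.8] -/
theorem selmerCardBoundTorsion_of_rankOne_primary (W : WeierstrassCurve ℚ) [W.IsElliptic]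
    [W.IsGloballyMinimal] (p : ℕ) [Fact p.Prime] (K : Type) [Field K] [NumberField K]
    (hPT : poitouTate_sum_localTatePairing_eq_zero K)
    (hEP : ∀ v : HeightOneSpectrum (𝓞 K), localEulerPoincareCharacteristic (v.adicCompletion K))
    (hmult : Mult W p) (hirr : Irr W p) (hK : IsImaginaryQuadratic K) (hsplit : SplitsIn K p)
    (hrank : (W.baseChange K).mordellWeilRank = 1)
    (hSha : Finite (AddCommGroup.primaryComponent (W.baseChange K).sha p))
    (P : (W.baseChange K).toAffine.Point) (hPinf : ¬ IsOfFinAddOrder P)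
    (𝔭 : HeightOneSpectrum (𝓞 K)) (h𝔭 : ((p : ℕ) : 𝓞 K) ∈ 𝔭.asIdeal)
    (he : 𝔭.asIdeal.ramificationIdx (𝓞 ℚ) = 1) (hf : 𝔭.asIdeal.inertiaDeg (𝓞 ℚ) = 1) :
    ∃ (_ : Finite (selmerAcBase (W.baseChange K) p 𝔭 ∅)) (a : ℕ),
      Nat.card (selmerAcBase (W.baseChange K) p 𝔭 ∅) *
          Nat.card (AddCommGroup.primaryComponent (W.baseChange ℚ_[p]).toAffine.Point p) ≤
        p ^ a ∧
      (a : ℤ) ≤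
        (padicValNat p (Nat.card (AddCommGroup.primaryComponent (W.baseChange K).sha p)) : ℤ) +
        2 * ((padicLogOrd W p (embAt K p 𝔭 h𝔭 he hf) P - 1) -
          (padicValNat p (AddSubgroup.zmultiples P).index : ℤ)) +
          padicValNat p (tamagawaProductAbove W K p) := by
  revert P
  set E := W.baseChange K with hEdef
  set G := W.baseChange ℚ_[p] with hGdef
  intro P hPinf
  haveI hEK : E.IsElliptic := by rw [hEdef, baseChange]; infer_instance
  have h2 : Module.finrank ℚ K = 2 := hK.1
  have hp : p.Prime := Fact.out
  -- Kolyvagin: `rank E(K) = 1`, `Ш(E/K)` finite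
  haveI := hSha
  set ιp := embAt K p 𝔭 h𝔭 he hf with hιp
  set f : E.toAffine.Point →+ G.toAffine.Point := Affine.Point.map (W' := W) ιp.toRatAlgHom with hfdef
  have hfapply : ∀ x, f x = padicPointOf W p ιp x := fun _ => rfl
  have hfinj : Function.Injective f := Affine.Point.map_injective (W' := W) ιp.toRatAlgHom
  -- no `p`-torsion in `E(K)` (from `Irr`, `K` quadratic)
  have hivK : ∀ x : E.toAffine.Point, p • x = 0 → x = 0 :=
    Transvection.forall_torsion_eq_zero_of_irr W p hirr K h2
  -- a coordinate `c : E(K) → ℤ` and a generator `Q`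
  obtain ⟨c, Q, hcQ, hcker⟩ := RankOne.exists_coord_of_mordellWeilRank_eq_one E hrank
  have hA : ∀ a : E.toAffine.Point, IsOfFinAddOrder (a - c a • Q) :=
    RankOne.isOfFinAddOrder_sub_coord_zsmul c Q hcQ hcker
  have hQinf : ¬ IsOfFinAddOrder Q := fun hQ => by
    have h := RankOne.coord_eq_zero_of_isOfFinAddOrder c hQ
    rw [hcQ] at h
    exact one_ne_zero h
  have hxinf : ¬ IsOfFinAddOrder (f Q) := fun hx => hQinf ((hfinj.isOfFinAddOrder_iff).mp hx)
  have hyinf : ¬ IsOfFinAddOrder (f P) := fun hy => hPinf ((hfinj.isOfFinAddOrder_iff).mp hy)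
  have hcP : c P ≠ 0 := fun h0 => hPinf (hcker P h0)
  -- the `ℤ_p`-coordinate `Ψ` on `E(ℚ_p)`: `Ψ(E(ℚ_p)) = p^m ℤ_p`, `p^m = #E(ℚ_p)[p^∞]`
  haveI hfi2 : (G.formalFiltration 2).FiniteIndex := G.finiteIndex_formalFiltration 2
  set cp := padicValNat p (G.localTamagawaNumber ℤ_[p]) with hcpdef
  obtain ⟨φ, hφ⟩ := LocalIndex.exists_addEquiv_valuation_psi_padicPointOf_of_mult W p hmult (K := K)
  obtain ⟨m, hmrange, hmcard, hmle⟩ :=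
    LocalIndex.exists_pow_eq_card_and_le_valuation_psi (G.formalFiltration 2) φ
  set Ψ := LocalIndex.psi (G.formalFiltration 2) φ with hΨ
  set eQ := (Ψ (f Q)).valuation with heQdef
  set eP := (Ψ (f P)).valuation with hePdef
  have hΨQ : Ψ (f Q) ≠ 0 := fun h0 => hxinf ((LocalIndex.psi_eq_zero_iff _ φ _).mp h0)
  have hmeQ : m ≤ eQ := hmle (f Q) hΨQ
  -- the exponents: `e(P) = padicLogOrd P + c_p − 1`, `e(P) = ord_p c(P) + e(Q)`
  have heP : (eP : ℤ) = padicLogOrd W p ιp P + cp - 1 := hφ ιp P hyinf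
  have hyx : f P = c P • f Q + f (P - c P • Q) := by rw [map_sub, map_zsmul]; abel
  have hePQ : eP = padicValNat p (c P).natAbs + eQ := by
    rw [hePdef, hyx]
    exact LocalIndex.valuation_psi_zsmul_add (G.formalFiltration 2) φ hxinf
      (f.isOfFinAddOrder (hA P)) hcP
  -- `ord_p [E(K) : ℤP] = ord_p |c(P)|`
  haveI : Finite (AddCommGroup.torsion E.toAffine.Point) := E.finite_torsion_point
  have hI : padicValNat p (AddSubgroup.zmultiples P).index = padicValNat p (c P).natAbs :=
    RankOne.padicValNat_index_zmultiples_eq c Q hcQ hcker hivK P hcP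
  -- (v) `ord_p ∏_{w∣p} c_w = 2 ord_p c_p`
  have htam : padicValNat p (tamagawaProductAbove W K p) = 2 * cp :=
    LocalIndexTransport.padicValNat_tamagawaProductAbove_eq_two_mul W K p h2 hsplit
  -- the two primes above `p`
  obtain ⟨σ, 𝔮, hσ, -, -, hall⟩ := LocalIndexTransport.exists_conj_prime_of_splitsIn K p h2 hsplit h𝔭
  have h𝔮 : ∀ v : HeightOneSpectrum (𝓞 K), v ≠ 𝔭 → ((p : ℕ) : 𝓞 K) ∈ v.asIdeal → v = 𝔮 :=
    fun v hv hpv => (hall v hpv).resolve_left hv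
  -- `Ш[p^k] ⊆ Ш[p^∞]`, `#Ш[p^∞] = p^v`
  set S := Nat.card (AddCommGroup.primaryComponent E.sha p) with hSdef
  obtain ⟨v, hv⟩ : ∃ v : ℕ, S = p ^ v := SelmerCount.exists_natCard_primaryComponent_eq_pow_of_finite p
  -- THE LEVEL BOUNDS
  set B : ℕ := (p ^ (eQ - m) * p ^ m) * (S * p ^ (eQ - m)) with hBdef
  have hlevel : ∀ k, Finite (acLevelStructure E p k 𝔭 ∅).selmerGroup ∧
      Nat.card (acLevelStructure E p k 𝔭 ∅).selmerGroup ≤ B := by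
    intro k
    rcases Nat.eq_zero_or_pos k with rfl | hk
    · obtain ⟨hfin, hle⟩ := finite_and_natCard_selmerGroup_acLevelStructure_zero E p 𝔭 ∅
      refine ⟨hfin, hle.trans ?_⟩
      have hS1 : 1 ≤ S := by rw [hv]; exact Nat.one_le_pow _ _ hp.pos
      calc 1 ≤ S := hS1
        _ ≤ S * p ^ (eQ - m) := Nat.le_mul_of_pos_right _ (pow_pos hp.pos _)
        _ ≤ (p ^ (eQ - m) * p ^ m) * (S * p ^ (eQ - m)) :=
            Nat.le_mul_of_pos_left _ (Nat.mul_pos (pow_pos hp.pos _) (pow_pos hp.pos _))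
    · -- the indices at level `k`, read in `E(ℚ_p)` through `Ψ`
      have hL₁ : ((Affine.Point.baseChange (W' := W.baseChange K) K (𝔭.adicCompletion K)).range ⊔
          (zsmulAddGroupHom ((p ^ k : ℕ) : ℤ) :
            ((W.baseChange K).baseChange (𝔭.adicCompletion K)).toAffine.Point →+ _).range).index ≤
          p ^ min k (eQ - m) * p ^ m := by
        rw [LocalIndexTransport.index_range_baseChange_sup_eq_padic K p 𝔭 h𝔭 he hf W,
          RankOne.range_zsmulAddGroupHom_natCast, sup_comm]
        change ((nsmulAddMonoidHom (p ^ k) : G.toAffine.Point →+ _).range ⊔ f.range).index ≤ _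
        rw [LocalIndex.range_nsmul_sup_range_eq_of_source f c Q hA k hivK, hmcard]
        exact LocalIndex.index_range_nsmul_sup_zmultiples_le (G.formalFiltration 2) φ hmrange
          (f Q) hxinf k
      have hM : (AddCommGroup.torsion ((W.baseChange K).baseChange (𝔭.adicCompletion K)).toAffine.Point ⊔
          (zsmulAddGroupHom ((p ^ k : ℕ) : ℤ) :
            ((W.baseChange K).baseChange (𝔭.adicCompletion K)).toAffine.Point →+ _).range).index =
          p ^ k := by
        rw [index_torsion_sup_range_zsmul_eq_padic K p 𝔭 h𝔭 he hf W,
          RankOne.range_zsmulAddGroupHom_natCast]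
        exact LocalIndex.index_torsion_sup_range_nsmul (G.formalFiltration 2) φ k
      have hN : ((zsmulAddGroupHom ((p ^ k : ℕ) : ℤ) : E.toAffine.Point →+ _).range).index =
          p ^ k := RankOne.index_range_zsmul_pow_eq c Q hcQ hcker hivK k
      have hL₂ : ((Affine.Point.baseChange (W' := W.baseChange K) K (𝔭.adicCompletion K)).range ⊔
          (AddCommGroup.torsion ((W.baseChange K).baseChange (𝔭.adicCompletion K)).toAffine.Point ⊔
            (zsmulAddGroupHom ((p ^ k : ℕ) : ℤ) :
              ((W.baseChange K).baseChange (𝔭.adicCompletion K)).toAffine.Point →+ _).range)).index =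
          p ^ min k (eQ - m) := by
        rw [index_range_baseChange_sup_torsion_sup_eq_padic K p 𝔭 h𝔭 he hf W,
          RankOne.range_zsmulAddGroupHom_natCast]
        change (f.range ⊔ (AddCommGroup.torsion G.toAffine.Point ⊔
          (nsmulAddMonoidHom (p ^ k) : G.toAffine.Point →+ _).range)).index = _
        have hrw : f.range ⊔ (AddCommGroup.torsion G.toAffine.Point ⊔
            (nsmulAddMonoidHom (p ^ k) : G.toAffine.Point →+ _).range) =
            AddCommGroup.torsion G.toAffine.Point ⊔
              ((nsmulAddMonoidHom (p ^ k) : G.toAffine.Point →+ _).range ⊔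
                AddSubgroup.zmultiples (f Q)) := by
          rw [← LocalIndex.range_nsmul_sup_range_eq_of_source f c Q hA k hivK]
          ac_rfl
        rw [hrw]
        exact LocalIndex.index_torsion_sup_range_nsmul_sup_zmultiples (G.formalFiltration 2) φ
          hmrange (f Q) hxinf k
      obtain ⟨hfin, hle⟩ := SelmerLevelBound.natCard_level_le_of_indices_torsion W K p k 𝔭 𝔮 hk
        σ hσ h𝔮 hPT (hEP 𝔮) rfl hM (pow_ne_zero _ hp.ne_zero) hN hL₂
        (SelmerCount.natCard_sha_inf_torsionBy_le_of_finite E p k).2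
      refine ⟨hfin, hle.trans ?_⟩
      have hmin : p ^ min k (eQ - m) ≤ p ^ (eQ - m) := Nat.pow_le_pow_right hp.pos (min_le_right _ _)
      exact Nat.mul_le_mul (hL₁.trans (Nat.mul_le_mul_right _ hmin))
        (Nat.mul_le_mul_left _ hmin)
  -- pass to the limit
  obtain ⟨hfinSel, hcard⟩ := LevelKummer.exists_finite_selmerAcBase_natCard_le E p 𝔭 ∅
    E.zsmul_geomPoints_surjective_holds B (fun k => (hlevel k).1) (fun k => (hlevel k).2)
  refine ⟨hfinSel, v + 2 * eQ, ?_, ?_⟩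
  · rw [← hmcard]
    calc Nat.card (selmerAcBase E p 𝔭 ∅) * p ^ m ≤ B * p ^ m := Nat.mul_le_mul_right _ hcard
      _ = p ^ (v + 2 * eQ) := by
          rw [hBdef, hv, ← pow_add, ← pow_add, ← pow_add, ← pow_add]
          congr 1
          omega
  · have hvS : padicValNat p S = v := by rw [hv, padicValNat.prime_pow]
    rw [hvS, hI, htam]
    have hePQZ : (eP : ℤ) = (padicValNat p (c P).natAbs : ℤ) + (eQ : ℤ) := by exact_mod_cast hePQ
    have hcast : (((v + 2 * eQ : ℕ) : ℤ)) = (v : ℤ) + 2 * (eQ : ℤ) := by push_cast; ring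
    have hcast2 : (((2 * cp : ℕ) : ℤ)) = 2 * (cp : ℤ) := by push_cast; ring
    rw [hcast, hcast2]
    linarith [hePQZ, heP]

end Summit.BirchSwinnertonDyer.Rank1Residual.X11b

end
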